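import Mathlib
import HarnessLib
import Summits.Ventures.LatticeQCDFlow.Exactness.NCMCGeneralSpaceReplicaTStatistic

/-!
# The limit law of the replica `t`-statistic has NO ATOMS, so the coverage of the replica-`t` interval converges — to a number that depends on `(R, q)` only

HONEST FRAMING: exact (Metropolis-corrected) sampling algorithms for lattice gauge theory;
figures of merit are autocorrelation/cost numbers at stated couplings and volumes; no
continuum-physics claim.

Venture `LatticeQCDFlow` (cell pub-lqcd), topic `Exactness`; FANOUT row 13 (`eng-snf`, GEN-23, replica
pooling).  NEW WORK of the cell against Mathlib (`iIndepFun_pi`, `Measure.measure_prod_null_of_ae_null`,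
`Polynomial.finite_setOf_isRoot`, `Measure.pi_hyperplane`, portmanteau
`ProbabilityMeasure.tendsto_measure_of_null_frontier_of_tendsto'`, `gaussianReal_map_const_mul`,
`Measure.pi_map_pi`) and the cell's `NCMCGeneralSpaceReplicaTStatistic`; not a published result; no
definition is introduced; nothing is cited as a fact (Student's `t_{R−1}` is NAMED ONLY).

WHY (row 13).  `NCMCGeneralSpaceReplicaTStatistic` gives `t(V_n) ⇒ t(Z)`, `Z ~ N(0, v)^{⊗R}`, for every
replica vector `V_n ⇒ N(0, v)^{⊗R}` (`v ≠ 0`, `R ≥ 2`), where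
`t(z) = z̄ / √(Σ_r (z_r − z̄)²/(R(R−1)))`.  To conclude that the COVERAGE of the printed replica-`t`
interval `{|t_n| ≤ q}` converges one needs the limit law not to charge `{|t| = q}` (portmanteau).  Here:
for every `q`, `N(0, v)^{⊗R}{z | z̄ = q·√(Σ_r (z_r − z̄)²/(R(R−1)))} = 0` — fix all coordinates but one;
the section is contained in the zero set of a quadratic polynomial which is non-zero unless all the
other coordinates vanish (a null event when `R ≥ 2`) — hence the law of `t(Z)` has no atoms,
`P(|t(V_n)| ≤ q) → N(0, v)^{⊗R}{|t| ≤ q}` for EVERY `q`, and by scale invariance of `t` that limit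
does not depend on `v`: it is a universal function of `(R, q)` (the Student-`t_{R−1}` probability of
`[−q, q]`, not identified here).  So the replica-jackknife / "many short chains" bar, read with a
quantile `q`, has ONE limiting coverage for every chain, observable and family of starts.

## Content
* `sumSqDev_eq_sum_sq_sub` (`Σ_r (z_r − z̄)² = Σ_r z_r² − (Σ_r z_r)²/R`); `indepFun_eval_update_pi`
  (`z_{r₀}` is independent of `update z r₀ 0` under a product law).
* **`pi_measure_setOf_mean_eq_mul_sqrt_eq_zero`** — `(⊗_r μ){z | z̄ = q √(Σ_r (z_r − z̄)²/(R(R−1)))} = 0`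
  for a product of atomless probability laws on `ℝ`, `R ≥ 2`, every `q`.
* **`pi_gaussianReal_measure_tStat_eq_eq_zero`** — `N(m, v)^{⊗R}{t = q} = 0` (`v ≠ 0`, `R ≥ 2`).
* **`tendsto_measure_abs_tStat_le_of_pi_gaussianReal`** — `V_n ⇒ N(0, v)^{⊗R}` ⇒
  `P(|t(V_n)| ≤ q) → N(0, v)^{⊗R}{|t| ≤ q}`, every `q ≥ 0`.
* **`pi_gaussianReal_measure_abs_tStat_le_eq`** — that limit is the same for every `v ≠ 0`.

NOT CLAIMED: the value of the limit (Student's `t_{R−1}`); anything numerical.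
-/

namespace Summit.Ventures.LatticeQCDFlow.Exactness.GeneralNCMC

open MeasureTheory ProbabilityTheory Filter Finset WithLp Function
open scoped ENNReal NNReal Topology

/-! ## §1 Algebra of the section polynomial -/

section Algebra

variable {ι : Type*} [Fintype ι]

/-- `Σ_r (z_r − z̄)² = Σ_r z_r² − (Σ_r z_r)²/R`. -/
theorem sumSqDev_eq_sum_sq_sub [Nonempty ι] (z : ι → ℝ) :
    ∑ r, (z r - (∑ r', z r') / (Fintype.card ι : ℝ)) ^ 2
      = ∑ r, z r ^ 2 - (∑ r, z r) ^ 2 / (Fintype.card ι : ℝ) := by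
  have hR : (Fintype.card ι : ℝ) ≠ 0 := Nat.cast_ne_zero.2 Fintype.card_ne_zero
  simp_rw [sub_sq, sum_add_distrib, sum_sub_distrib, sum_const, card_univ, nsmul_eq_mul]
  rw [← sum_mul, ← mul_sum]
  field_simp
  ring

/-- Sums of an updated vector: `Σ_r (update y r₀ x)_r = x + Σ_{r ≠ r₀} y_r`. -/
theorem sum_update_eq [DecidableEq ι] (y : ι → ℝ) (r₀ : ι) (x : ℝ) :
    ∑ r, update y r₀ x r = x + ∑ r ∈ univ.erase r₀, y r := by
  rw [sum_update_of_mem (mem_univ r₀), sdiff_singleton_eq_erase]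

/-- Sums of squares of an updated vector: `Σ_r (update y r₀ x)_r² = x² + Σ_{r ≠ r₀} y_r²`. -/
theorem sum_sq_update_eq [DecidableEq ι] (y : ι → ℝ) (r₀ : ι) (x : ℝ) :
    ∑ r, update y r₀ x r ^ 2 = x ^ 2 + ∑ r ∈ univ.erase r₀, y r ^ 2 := by
  have h : ∀ r, update y r₀ x r ^ 2 = update (fun r => y r ^ 2) r₀ (x ^ 2) r := fun r => by
    simp only [update_apply]
    split_ifs <;> rfl
  simp_rw [h]
  rw [sum_update_of_mem (mem_univ r₀), sdiff_singleton_eq_erase]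

/-- **The section polynomial.**  If `z = update y r₀ x` satisfies `z̄ = q √(Σ_r (z_r − z̄)²/(R(R−1)))`
(`R ≥ 2`), then `x` is a root of `(R − 1 + q²)(x + c)² − q² R (x² + K)` with `c = Σ_{r ≠ r₀} y_r`,
`K = Σ_{r ≠ r₀} y_r²`. -/
theorem section_poly_eval_eq_zero [Nontrivial ι] [DecidableEq ι] (y : ι → ℝ) (r₀ : ι) (q x : ℝ)
    (h : (∑ r, update y r₀ x r) / (Fintype.card ι : ℝ)
      = q * Real.sqrt ((∑ r, (update y r₀ x r - (∑ r', update y r₀ x r') / (Fintype.card ι : ℝ)) ^ 2)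
          / ((Fintype.card ι : ℝ) * (Fintype.card ι - 1)))) :
    ((Fintype.card ι : ℝ) - 1 + q ^ 2) * (x + ∑ r ∈ univ.erase r₀, y r) ^ 2
      - q ^ 2 * Fintype.card ι * (x ^ 2 + ∑ r ∈ univ.erase r₀, y r ^ 2) = 0 := by
  have hR1 : (1 : ℝ) < Fintype.card ι := by exact_mod_cast Fintype.one_lt_card
  have hR : (Fintype.card ι : ℝ) ≠ 0 := by positivity
  have hRm : (Fintype.card ι : ℝ) - 1 ≠ 0 := by linarith
  set R : ℝ := (Fintype.card ι : ℝ) with hRdef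
  set c := ∑ r ∈ univ.erase r₀, y r
  set K := ∑ r ∈ univ.erase r₀, y r ^ 2
  have hS : ∑ r, update y r₀ x r = x + c := sum_update_eq y r₀ x
  have hQ : ∑ r, update y r₀ x r ^ 2 = x ^ 2 + K := sum_sq_update_eq y r₀ x
  have hD : ∑ r, (update y r₀ x r - (∑ r', update y r₀ x r') / R) ^ 2
      = x ^ 2 + K - (x + c) ^ 2 / R := by
    rw [sumSqDev_eq_sum_sq_sub, hQ, hS]
  rw [hD, hS] at h
  -- square the defining relation: `a = q √b`, `b ≥ 0` ⇒ `a² = q² b`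
  have hb : 0 ≤ (x ^ 2 + K - (x + c) ^ 2 / R) / (R * (R - 1)) := by
    rw [← hD]
    exact div_nonneg (sum_nonneg fun r _ => sq_nonneg _) (mul_nonneg (by linarith) (by linarith))
  have hsq : ((x + c) / R) ^ 2 = q ^ 2 * ((x ^ 2 + K - (x + c) ^ 2 / R) / (R * (R - 1))) := by
    rw [h, mul_pow, Real.sq_sqrt hb]
  field_simp at hsq
  linear_combination hsq

end Algebra

/-! ## §2 The section in one coordinate is finite unless all other coordinates vanish -/

section FiniteSection

variable {ι : Type*} [Fintype ι] [Nontrivial ι] [DecidableEq ι]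

open Polynomial in
/-- **Finite sections.**  If some `y_r ≠ 0` (`r ≠ r₀`), the set of `x` for which `z = update y r₀ x`
satisfies `z̄ = q √(Σ_r (z_r − z̄)²/(R(R−1)))` is finite: it lies in the zero set of the quadratic
`(R−1)(1−q²) X² + 2c(R−1+q²) X + ((R−1+q²)c² − q²RK)`, whose three coefficients cannot all vanish when
`K = Σ_{r ≠ r₀} y_r² > 0`. -/
theorem finite_setOf_mean_update_eq_mul_sqrt (y : ι → ℝ) (r₀ : ι) (q : ℝ)
    (hy : ∃ r ∈ univ.erase r₀, y r ≠ 0) :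
    Set.Finite {x : ℝ | (∑ r, update y r₀ x r) / (Fintype.card ι : ℝ)
      = q * Real.sqrt ((∑ r, (update y r₀ x r - (∑ r', update y r₀ x r') / (Fintype.card ι : ℝ)) ^ 2)
          / ((Fintype.card ι : ℝ) * (Fintype.card ι - 1)))} := by
  set R : ℝ := (Fintype.card ι : ℝ) with hRdef
  set c := ∑ r ∈ univ.erase r₀, y r with hc
  set K := ∑ r ∈ univ.erase r₀, y r ^ 2 with hK
  have hR1 : (1 : ℝ) < R := by rw [hRdef]; exact_mod_cast Fintype.one_lt_card
  have hKpos : 0 < K := by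
    obtain ⟨r, hr, hyr⟩ := hy
    exact lt_of_lt_of_le (by positivity : 0 < y r ^ 2)
      (single_le_sum (f := fun i => y i ^ 2) (fun i _ => sq_nonneg (y i)) hr)
  set p : ℝ[X] := C ((R - 1) * (1 - q ^ 2)) * X ^ 2 + C (2 * c * (R - 1 + q ^ 2)) * X
    + C ((R - 1 + q ^ 2) * c ^ 2 - q ^ 2 * R * K) with hp
  have heval : ∀ x, p.eval x = (R - 1 + q ^ 2) * (x + c) ^ 2 - q ^ 2 * R * (x ^ 2 + K) := by
    intro x
    simp only [hp, eval_add, eval_mul, eval_C, eval_pow, eval_X]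
    ring
  have hp0 : p ≠ 0 := by
    intro h0
    have h2 : p.coeff 2 = 0 := by rw [h0, coeff_zero]
    have h1 : p.coeff 1 = 0 := by rw [h0, coeff_zero]
    have h0' : p.coeff 0 = 0 := by rw [h0, coeff_zero]
    simp only [hp, coeff_add, coeff_C_mul, coeff_X_pow, coeff_X, coeff_C] at h2 h1 h0'
    norm_num at h2 h1 h0'
    have hq1 : q ^ 2 = 1 := by
      rcases h2 with h | h
      · linarith
      · linarith
    have hc0 : c = 0 := by
      have hpos : 0 < R - 1 + q ^ 2 := by nlinarith [sq_nonneg q]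
      rcases h1 with h | h
      · exact h
      · linarith
    rw [hc0, hq1] at h0'
    have hRK : 0 < R * K := mul_pos (by linarith) hKpos
    nlinarith
  refine (Polynomial.finite_setOf_isRoot hp0).subset fun x hx => ?_
  show p.eval x = 0
  rw [heval]
  exact section_poly_eval_eq_zero y r₀ q x hx

end FiniteSection

/-! ## §3 A product law with atomless factors does not charge `{z̄ = q √(Σ_r (z_r − z̄)²/(R(R−1)))}` -/

section NullSet

variable {ι : Type*} [Fintype ι] [Nontrivial ι]

omit [Nontrivial ι] in
/-- Under a product law, the coordinate `z_{r₀}` is independent of the vector with that coordinate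
zeroed. -/
theorem indepFun_eval_update_pi [DecidableEq ι] {μ : ι → Measure ℝ}
    [∀ i, IsProbabilityMeasure (μ i)] (r₀ : ι) :
    IndepFun (fun z : ι → ℝ => z r₀) (fun z : ι → ℝ => update z r₀ 0) (Measure.pi μ) := by
  have hind : iIndepFun (fun i (z : ι → ℝ) => z i) (Measure.pi μ) :=
    iIndepFun_pi (X := fun _ => id) fun _ => aemeasurable_id
  have h2 := hind.indepFun_finset {r₀} (univ.erase r₀)
    (disjoint_singleton_left.2 (notMem_erase r₀ univ)) (fun i => measurable_pi_apply i)
  let G : (↥(univ.erase r₀) → ℝ) → (ι → ℝ) := fun g i =>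
    if h : i = r₀ then 0 else g ⟨i, mem_erase.2 ⟨h, mem_univ i⟩⟩
  have hG : Measurable G := by
    refine measurable_pi_lambda _ fun i => ?_
    by_cases h : i = r₀
    · simp only [G, h, dite_true]
      exact measurable_const
    · simp only [G, h, dite_false]
      exact measurable_pi_apply _
  have hX : (fun z : ι → ℝ => z r₀)
      = (fun g : ↥({r₀} : Finset ι) → ℝ => g ⟨r₀, mem_singleton_self r₀⟩)
        ∘ (fun (z : ι → ℝ) (i : ↥({r₀} : Finset ι)) => z i) := rfl
  have hY : (fun z : ι → ℝ => update z r₀ 0)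
      = G ∘ (fun (z : ι → ℝ) (i : ↥(univ.erase r₀)) => z i) := by
    funext z i
    by_cases h : i = r₀
    · subst h
      simp [G]
    · simp [G, h]
  rw [hX, hY]
  exact h2.comp (measurable_pi_apply _) hG

omit [Nontrivial ι] in
/-- The defining set `{z | z̄ = q √(Σ_r (z_r − z̄)²/(R(R−1)))}` is measurable. -/
theorem measurableSet_setOf_mean_eq_mul_sqrt (q : ℝ) :
    MeasurableSet {z : ι → ℝ | (∑ r, z r) / (Fintype.card ι : ℝ)
      = q * Real.sqrt ((∑ r, (z r - (∑ r', z r') / (Fintype.card ι : ℝ)) ^ 2)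
          / ((Fintype.card ι : ℝ) * (Fintype.card ι - 1)))} := by
  have hc : ∀ r : ι, Measurable fun z : ι → ℝ => z r := fun r => measurable_pi_apply r
  refine measurableSet_eq_fun (by fun_prop) ?_
  have h1 : Continuous fun z : ι → ℝ => Real.sqrt ((∑ r, (z r - (∑ r', z r')
      / (Fintype.card ι : ℝ)) ^ 2) / ((Fintype.card ι : ℝ) * (Fintype.card ι - 1))) := by
    fun_prop
  exact measurable_const.mul h1.measurable

/-- **A PRODUCT OF ATOMLESS PROBABILITY LAWS DOES NOT CHARGE `{z | z̄ = q √(Σ_r (z_r − z̄)²/(R(R−1)))}`**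
(`R ≥ 2`, every `q`): fix the coordinates `r ≠ r₀`; unless they all vanish (a null event, since
`R ≥ 2` and the factors are atomless) the `z_{r₀}`-section is finite (§2), hence null. -/
theorem pi_measure_setOf_mean_eq_mul_sqrt_eq_zero {μ : ι → Measure ℝ}
    [∀ i, IsProbabilityMeasure (μ i)] [∀ i, NullSingletonClass (μ i)] (q : ℝ) :
    Measure.pi μ {z : ι → ℝ | (∑ r, z r) / (Fintype.card ι : ℝ)
      = q * Real.sqrt ((∑ r, (z r - (∑ r', z r') / (Fintype.card ι : ℝ)) ^ 2)
          / ((Fintype.card ι : ℝ) * (Fintype.card ι - 1)))} = 0 := by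
  classical
  obtain ⟨r₀, s₁, hne⟩ := exists_pair_ne ι
  -- the set `D ⊆ (ι → ℝ) × ℝ` of pairs `(y, x)` with `update y r₀ x` in the defining set
  let D : Set ((ι → ℝ) × ℝ) := {p | (∑ r, update p.1 r₀ p.2 r) / (Fintype.card ι : ℝ)
      = q * Real.sqrt ((∑ r, (update p.1 r₀ p.2 r - (∑ r', update p.1 r₀ p.2 r')
          / (Fintype.card ι : ℝ)) ^ 2) / ((Fintype.card ι : ℝ) * (Fintype.card ι - 1)))}
  have hDm : MeasurableSet D := (measurableSet_setOf_mean_eq_mul_sqrt q).preimage measurable_update'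
  have hrepr : {z : ι → ℝ | (∑ r, z r) / (Fintype.card ι : ℝ)
      = q * Real.sqrt ((∑ r, (z r - (∑ r', z r') / (Fintype.card ι : ℝ)) ^ 2)
          / ((Fintype.card ι : ℝ) * (Fintype.card ι - 1)))}
      = (fun z : ι → ℝ => (update z r₀ 0, z r₀)) ⁻¹' D := by
    ext z
    simp only [D, Set.mem_preimage, Set.mem_setOf_eq, update_idem, update_eq_self]
  -- the law of the pair is a product (independence), the second marginal is `μ r₀`
  have hpair : (Measure.pi μ).map (fun z : ι → ℝ => (update z r₀ 0, z r₀))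
      = ((Measure.pi μ).map (fun z : ι → ℝ => update z r₀ 0)).prod (μ r₀) := by
    rw [(indepFun_iff_map_prod_eq_prod_map_map measurable_update_left.aemeasurable
      (measurable_pi_apply r₀).aemeasurable).1 (indepFun_eval_update_pi r₀).symm,
      (measurePreserving_eval μ r₀).map_eq]
  rw [hrepr, ← Measure.map_apply (measurable_update_left.prodMk (measurable_pi_apply r₀)) hDm,
    hpair]
  refine Measure.measure_prod_null_of_ae_null hDm ?_
  -- the bad `y`'s (all coordinates `≠ r₀` vanish) are contained in the null hyperplane `{y_{s₁} = 0}`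
  have hbad : ((Measure.pi μ).map (fun z : ι → ℝ => update z r₀ 0)) {y | y s₁ = 0} = 0 := by
    rw [Measure.map_apply measurable_update_left
      (measurableSet_eq_fun (measurable_pi_apply s₁) measurable_const)]
    have hpre : (fun z : ι → ℝ => update z r₀ 0) ⁻¹' {y : ι → ℝ | y s₁ = 0} = {z | z s₁ = 0} := by
      ext z
      simp [update_of_ne hne.symm]
    rw [hpre]
    exact Measure.pi_hyperplane μ s₁ 0
  rw [Filter.EventuallyEq, ae_iff]
  refine measure_mono_null (fun y hy => ?_) hbad
  simp only [Pi.zero_apply, Set.mem_setOf_eq] at hy ⊢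
  by_contra hys
  exact hy ((finite_setOf_mean_update_eq_mul_sqrt y r₀ q
    ⟨s₁, mem_erase.2 ⟨hne.symm, mem_univ _⟩, hys⟩).measure_zero (μ r₀))

end NullSet

/-! ## §4 Consequences for the replica `t`-statistic -/

section TStat

variable {ι : Type*} [Fintype ι] [Nontrivial ι]

omit [Nontrivial ι] in
/-- `t` is Borel measurable on `ι → ℝ`. -/
theorem measurable_tStat_pi :
    Measurable fun z : ι → ℝ =>
      (∑ r, z r) / Fintype.card ι
        / Real.sqrt ((∑ r, (z r - (∑ r', z r') / Fintype.card ι) ^ 2)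
            / ((Fintype.card ι : ℝ) * (Fintype.card ι - 1))) := by
  have hc : ∀ r : ι, Measurable fun z : ι → ℝ => z r := fun r => measurable_pi_apply r
  have hnum : Measurable fun z : ι → ℝ => (∑ r, z r) / (Fintype.card ι : ℝ) := by fun_prop
  have hden : Continuous fun z : ι → ℝ => Real.sqrt ((∑ r, (z r - (∑ r', z r')
      / (Fintype.card ι : ℝ)) ^ 2) / ((Fintype.card ι : ℝ) * (Fintype.card ι - 1))) := by
    fun_prop
  exact hnum.div hden.measurable

/-- **THE LAW OF `t(Z)`, `Z ~ N(m, v)^{⊗R}` (`v ≠ 0`, `R ≥ 2`), HAS NO ATOMS**: `P(t(Z) = q) = 0` for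
every `q` (`{t = q} ⊆ {z̄ = q √(SSD/(R(R−1)))} ∪ {SSD = 0}`, both null). -/
theorem pi_gaussianReal_measure_tStat_eq_eq_zero (m : ℝ) {v : ℝ≥0} (hv : v ≠ 0) (q : ℝ) :
    Measure.pi (fun _ : ι => gaussianReal m v) {z : ι → ℝ |
      (∑ r, z r) / Fintype.card ι
        / Real.sqrt ((∑ r, (z r - (∑ r', z r') / Fintype.card ι) ^ 2)
            / ((Fintype.card ι : ℝ) * (Fintype.card ι - 1))) = q} = 0 := by
  have : NullSingletonClass (gaussianReal m v) := nullSingletonClass_gaussianReal hv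
  have hR1 : (1 : ℝ) < Fintype.card ι := by exact_mod_cast Fintype.one_lt_card
  refine measure_mono_null (fun z hz => ?_) (measure_union_null
    (pi_measure_setOf_mean_eq_mul_sqrt_eq_zero (μ := fun _ : ι => gaussianReal m v) q)
    (ae_iff.1 (ae_sumSqDev_ne_zero_pi_gaussianReal (ι := ι) m hv)))
  simp only [Set.mem_union, Set.mem_setOf_eq, not_not]
  simp only [Set.mem_setOf_eq] at hz
  by_cases h0 : (∑ r, (z r - (∑ r', z r') / (Fintype.card ι : ℝ)) ^ 2) = 0
  · exact Or.inr h0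
  · left
    have hg : 0 < Real.sqrt ((∑ r, (z r - (∑ r', z r') / (Fintype.card ι : ℝ)) ^ 2)
        / ((Fintype.card ι : ℝ) * (Fintype.card ι - 1))) :=
      Real.sqrt_pos.2 (div_pos (lt_of_le_of_ne (sum_nonneg fun r _ => sq_nonneg _) (Ne.symm h0))
        (mul_pos (by linarith) (by linarith)))
    rw [← hz]
    exact (div_mul_cancel₀ _ hg.ne').symm

/-- **The law of `t(Z)` as a measure on `ℝ` has no atoms.** -/
theorem nullSingletonClass_map_tStat_pi_gaussianReal (m : ℝ) {v : ℝ≥0} (hv : v ≠ 0) :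
    NullSingletonClass ((Measure.pi fun _ : ι => gaussianReal m v).map fun z : ι → ℝ =>
      (∑ r, z r) / Fintype.card ι
        / Real.sqrt ((∑ r, (z r - (∑ r', z r') / Fintype.card ι) ^ 2)
            / ((Fintype.card ι : ℝ) * (Fintype.card ι - 1)))) :=
  ⟨fun q => by
    rw [Measure.map_apply measurable_tStat_pi (measurableSet_singleton q)]
    exact pi_gaussianReal_measure_tStat_eq_eq_zero m hv q⟩

/-- **THE COVERAGE OF THE REPLICA-`t` INTERVAL CONVERGES, FOR EVERY QUANTILE.**  If the replica vector
`V_n ⇒ N(0, v)^{⊗R}` in `EuclideanSpace ℝ ι` (`v ≠ 0`, `R ≥ 2`), then for every `q ≥ 0`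
`P(|t(V_n)| ≤ q) → N(0, v)^{⊗R}{z | |t(z)| ≤ q}` (portmanteau: the limit law does not charge `{±q}`). -/
theorem tendsto_measure_abs_tStat_le_of_pi_gaussianReal {Ω₀ : Type*} [MeasurableSpace Ω₀]
    {P : Measure Ω₀} [IsProbabilityMeasure P] {V : ℕ → Ω₀ → PiLp 2 (fun _ : ι => ℝ)} {v : ℝ≥0}
    (hv : v ≠ 0)
    (h : TendstoInDistribution V atTop (toLp 2) (fun _ => P)
      (Measure.pi fun _ : ι => gaussianReal 0 v)) {q : ℝ} (hq : 0 ≤ q) :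
    Tendsto (fun n => P {ω | |(∑ r, V n ω r) / Fintype.card ι
        / Real.sqrt ((∑ r, (V n ω r - (∑ r', V n ω r') / Fintype.card ι) ^ 2)
            / ((Fintype.card ι : ℝ) * (Fintype.card ι - 1)))| ≤ q}) atTop
      (𝓝 ((Measure.pi fun _ : ι => gaussianReal 0 v) {z : ι → ℝ | |(∑ r, z r) / Fintype.card ι
        / Real.sqrt ((∑ r, (z r - (∑ r', z r') / Fintype.card ι) ^ 2)
            / ((Fintype.card ι : ℝ) * (Fintype.card ι - 1)))| ≤ q})) := by
  have hT := tendstoInDistribution_tStat_of_pi_gaussianReal hv h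
  have hnull : ((Measure.pi fun _ : ι => gaussianReal 0 v).map fun z : ι → ℝ =>
      (∑ r, z r) / Fintype.card ι
        / Real.sqrt ((∑ r, (z r - (∑ r', z r') / Fintype.card ι) ^ 2)
            / ((Fintype.card ι : ℝ) * (Fintype.card ι - 1)))) (frontier (Set.Icc (-q) q)) = 0 := by
    rw [frontier_Icc (by linarith : -q ≤ q)]
    haveI := nullSingletonClass_map_tStat_pi_gaussianReal (ι := ι) 0 hv
    exact (Set.toFinite {-q, q}).measure_zero _
  have key := ProbabilityMeasure.tendsto_measure_of_null_frontier_of_tendsto' hT.tendsto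
    (E := Set.Icc (-q) q) (by simpa using hnull)
  simp only [ProbabilityMeasure.coe_mk] at key
  rw [Measure.map_apply_of_aemeasurable hT.aemeasurable_limit measurableSet_Icc] at key
  have hlim : (fun z : ι → ℝ => (∑ r, z r) / Fintype.card ι
        / Real.sqrt ((∑ r, (z r - (∑ r', z r') / Fintype.card ι) ^ 2)
            / ((Fintype.card ι : ℝ) * (Fintype.card ι - 1)))) ⁻¹' Set.Icc (-q) q
      = {z : ι → ℝ | |(∑ r, z r) / Fintype.card ι
        / Real.sqrt ((∑ r, (z r - (∑ r', z r') / Fintype.card ι) ^ 2)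
            / ((Fintype.card ι : ℝ) * (Fintype.card ι - 1)))| ≤ q} := by
    ext z
    simp only [Set.mem_preimage, Set.mem_Icc, Set.mem_setOf_eq, abs_le]
  rw [hlim] at key
  refine key.congr fun n => ?_
  rw [Measure.map_apply_of_aemeasurable (hT.forall_aemeasurable n) measurableSet_Icc]
  congr 1
  ext ω
  simp only [Set.mem_preimage, Set.mem_Icc, Set.mem_setOf_eq, abs_le]

omit [Nontrivial ι] in
/-- **THAT LIMIT DEPENDS ON `(R, q)` ONLY**: `N(0, v)^{⊗R}{|t| ≤ q} = N(0, 1)^{⊗R}{|t| ≤ q}` for every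
`v ≠ 0` (scale invariance of `t`; `N(0, v) = (√v ·)_* N(0, 1)`). -/
theorem pi_gaussianReal_measure_abs_tStat_le_eq {v : ℝ≥0} (hv : v ≠ 0) (q : ℝ) :
    (Measure.pi fun _ : ι => gaussianReal 0 v) {z : ι → ℝ | |(∑ r, z r) / Fintype.card ι
        / Real.sqrt ((∑ r, (z r - (∑ r', z r') / Fintype.card ι) ^ 2)
            / ((Fintype.card ι : ℝ) * (Fintype.card ι - 1)))| ≤ q}
      = (Measure.pi fun _ : ι => gaussianReal 0 1) {z : ι → ℝ | |(∑ r, z r) / Fintype.card ι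
        / Real.sqrt ((∑ r, (z r - (∑ r', z r') / Fintype.card ι) ^ 2)
            / ((Fintype.card ι : ℝ) * (Fintype.card ι - 1)))| ≤ q} := by
  have hvpos : 0 < Real.sqrt v := Real.sqrt_pos.2 (by exact_mod_cast pos_iff_ne_zero.2 hv)
  have hmap : (Measure.pi fun _ : ι => gaussianReal 0 v)
      = (Measure.pi fun _ : ι => gaussianReal 0 1).map (fun z i => Real.sqrt v * z i) := by
    rw [Measure.pi_map_pi (fun _ => (measurable_const_mul _).aemeasurable)]
    congr 1
    funext i
    rw [gaussianReal_map_const_mul, mul_zero, mul_one]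
    congr 1
    ext
    simp [Real.sq_sqrt (NNReal.coe_nonneg v)]
  have hS : MeasurableSet {z : ι → ℝ | |(∑ r, z r) / Fintype.card ι
        / Real.sqrt ((∑ r, (z r - (∑ r', z r') / Fintype.card ι) ^ 2)
            / ((Fintype.card ι : ℝ) * (Fintype.card ι - 1)))| ≤ q} :=
    measurableSet_le measurable_tStat_pi.abs measurable_const
  rw [hmap, Measure.map_apply (measurable_pi_lambda _ fun i => (measurable_pi_apply i).const_mul _) hS]
  congr 1
  ext z
  simp only [Set.mem_preimage, Set.mem_setOf_eq]
  rw [tStat_mul_left z hvpos]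

end TStat

end Summit.Ventures.LatticeQCDFlow.Exactness.GeneralNCMC
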